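import Summits.QuantumFields.BalabanUV.Beta.GAN24.CapacitanceScalarBoundsBorder
import Summits.QuantumFields.BalabanUV.Beta.GAN24.CapacitanceClosedFormGauge

/-!
# `BalabanUV.Beta.GAN24.CapacitanceCancellation` — binder row G-an2-4 / (CONV-C), road P1-fibre, typer row **P1-Y08cc** (node N10c′ of
# `GAN24/Formal/DAG.md`), PART 1: the ZERO-ALIAS IDENTITY `σ⁰·h⁰ = 2` and the `m ≠ 0` SHARES of the capacitance scalars, in leaf-12's real
# currency (PART 2 `CapacitanceCancellationDefect`: the defect `σh − 2 = O(|p|⁴)` and `(Cap⁻¹)_cc = O(|p|⁸/N^{D+4})`)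

NOT IN PRINT; OUR PROOF ATTEMPT.  HONEST FRAMING (cell contract, verbatim): «discharging `BetaPertH` makes Bałaban's UV stability UNCONDITIONAL — a real
constructive-QFT result; it is NOT the continuum limit and NOT the Clay problem.»  HONEST DEPENDENCY (verbatim): «continuum YM on T⁴ ⇐ BetaPertH ∧ nine spine
estimates (0/9 proved); BetaPertH ⇐ (D1) ∧ (D4) ∧ CAP+tail; G-an2-4 gates asym, D1 and NE2/3/4.»  [folklore] explicit analysis (Jordan's inequality, the
closed form of the geometric sum, leaf P1-L06's alias-sum bound); no cited fact, no `def … : Prop`, no wall binder; it discharges NOTHING of (CONV-C)'s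
K-slot `GAN24.CombesThomas.ConvCK 3 Lc` by itself.  NOT `BetaPertH`, NOT continuum, NOT Clay.  NOT summit progress.

## Why (journal erratum l.2746 of leaf-02-g4; typer LEAVES.md v2.3)
The no-cancellation bound `|(Cap⁻¹)_cc| ≤ ς/2 + ς²η = O(|p|⁴/N^{D+4})` of `CapacitanceClosedForm.norm_invcc_le` feeds a pure-gauge pole `N²|f̂₀|/|p|²`
into the `m = 0` field block; the c-channel needs the cancellation `(Cap⁻¹)_cc = (σh − 2)/(2σ²h)` (`CapacitanceClosedFormGauge.invcc_eq_cancel`) with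
`σh − 2` SMALL.  The algebra (`sigma0_mul_hSum0_eq_two`, `defect_split`) is leaf-02's; THIS FILE supplies the analysis in the REAL alias-sum currency of
leaf-12 (`CapacitanceScalarBounds.capDiag = a_κ`, `CapacitanceScalarBoundsBorder.capBorder = σ`, `capH = h`; `blockWt = w_m`, `gNormSq`, L06's
`kfine`, `lapR = L_m`, `wMaj`, `aliasWtConst = (5^D − 1)/4`), at real `p ∈ [−π, π]^D ∖ {0}`, every `N ≥ 1`, every `D`:
* §1 **the `|p|²`-carrying weight of a NONZERO alias** (new; refines L06's `sinWt ≤ wMaj` by keeping the numerator): for `m_i ≠ 0`,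
  `‖G(k_{m,i}, N)‖² = sin²(p_i/2)/sin²(k_{m,i}/2) ≤ (p_i²/4)·N²·wMaj N (m i)` (`gNormSq_kfine_le_of_ne_zero`), hence
  `w_m ≤ (|p|²/4)·N^D·Π_i wMaj N (m i)` for `m ≠ 0` (`blockWt_le_momSq_of_ne_zero`) — every nonzero alias weight vanishes to second order at `p → 0`;
* §2 the zero-alias data `a⁰_κ = capDiagZero`, `σ⁰ = capBorderZero`, `h⁰ = capHZero` (the `m = 0` summands, SAME expressions as leaf-12's
  `capDiag_zero_term_ge`) and **`capBorderZero_mul_capHZero : σ⁰·h⁰ = 2`** EXACTLY (the one-coordinate telescoping identity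
  `‖G(p_κ/N, N)‖²·4 sin²(p_κ/(2N)) = 4 sin²(p_κ/2)`, summed: `Σ_κ 4 sin²(p_κ/2)/‖G‖² = L₀`);
* §3 the shares: `a⁰_κ ≤ a_κ`, `σ⁰ ≤ σ`; the row's `p`-FREE bounds `a_κ − a⁰_κ ≤ (aliasWtConst D/2)·N^{D+4}`, `σ − σ⁰ ≤ (aliasWtConst D/4)·N^{D+4}`
  (`capDiag_sub_zero_le`, `capBorder_sub_zero_le`), and the SHARPER `|p|²`-carrying bounds `a_κ − a⁰_κ ≤ (aliasWtConst D/8)·|p|²·N^{D+4}`,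
  `σ − σ⁰ ≤ (aliasWtConst D/16)·|p|²·N^{D+4}` (`capDiag_sub_zero_le_momSq`, `capBorder_sub_zero_le_momSq`) — these give the defect the order `|p|⁴`
  (with the `p`-free shares one only gets `|p|²`, i.e. `(Cap⁻¹)_cc = O(|p|⁶/N^{D+4})`);
* §4 sizes of the zero-alias data: `a⁰_κ ≥ (4/π²)^{D+1}N^{D+4}/(2|p|²)` (leaf-12 by name), `σ⁰ ≤ π⁴N^{D+4}/(16|p|⁴)`.
Constants explicit and symbolic in `D` (ref2 c3); `|p|² = King1986.momSq p`.  Unit `b2b-balaban-gan24-formalise-leaf-09` (gen 5), 2026-08-20.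
-/

noncomputable section

open Complex Finset
open scoped BigOperators Real

namespace Summit.QuantumFields.BalabanUV.Beta.GAN24.CapacitanceCancellation

open AliasWeights AliasWeightsSum CapacitanceScalarBounds CapacitanceScalarBoundsBorder
open Literature.MathematicalPhysics.QuantumFieldTheory.King1986 (momSq momSq_nonneg)

variable {D : ℕ}

/-! ## §1 The `|p|²`-carrying weight of a NONZERO alias (refines leaf P1-L06's `sinWt ≤ wMaj` by the numerator `sin²(p_i/2)`) -/

/-- [folklore] For a nonzero alias coordinate `m_i ≠ 0` (`|p_i| ≤ π`): `‖G(k_{m,i}, N)‖² = sin²(p_i/2)/sin²(k_{m,i}/2) ≤ (p_i²/4)·N²·wMaj N (m i)`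
— the block-average weight of a nonzero alias VANISHES to second order at `p → 0`. -/
theorem gNormSq_kfine_le_of_ne_zero {N : ℕ} [NeZero N] {p : Fin D → ℝ} (hp : ∀ i, |p i| ≤ π) (m : Fin D → ZMod N)
    {i : Fin D} (hi : m i ≠ 0) :
    gNormSq N (kfine N p m i) ≤ (p i) ^ 2 / 4 * ((N : ℝ) ^ 2 * wMaj N (m i)) := by
  have hv0 : 1 ≤ (m i).val := Nat.one_le_iff_ne_zero.2 fun h0 => hi ((ZMod.val_eq_zero _).1 h0)
  have hvN : (m i).val + 1 ≤ N := ZMod.val_lt (m i)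
  have hfold := fold_le_mul_abs_sin (hp i) hv0 hvN
  have hf1 : (1 : ℝ) ≤ ((min (m i).val (N - (m i).val) : ℕ) : ℝ) := by exact_mod_cast le_min hv0 (by omega)
  set x : ℝ := kfine N p m i with hxdef
  have hx2 : (p i + 2 * π * ((m i).val : ℕ)) / N / 2 = x / 2 := by rw [hxdef]; rfl
  rw [hx2] at hfold
  have hNs : 0 < (N : ℝ) * |Real.sin (x / 2)| := lt_of_lt_of_le (lt_of_lt_of_le one_pos hf1) hfold
  have hsin0 : Real.sin (x / 2) ≠ 0 := by
    intro h0; rw [h0, abs_zero, mul_zero] at hNs; exact lt_irrefl _ hNs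
  have hN0 : (0 : ℝ) < N := by
    have : (N : ℝ) ≠ 0 := fun h => by rw [h, zero_mul] at hNs; exact lt_irrefl _ hNs
    exact lt_of_le_of_ne (Nat.cast_nonneg N) (Ne.symm this)
  -- numerator: `sin (N x / 2) = ± sin (p_i / 2)`
  have hnum : Real.sin (N * x / 2) ^ 2 = Real.sin (p i / 2) ^ 2 := by
    have e : (N : ℝ) * x / 2 = p i / 2 + ((m i).val : ℕ) * π := by
      rw [hxdef]; unfold kfine; field_simp
    rw [e, Real.sin_add_nat_mul_pi]
    rcases neg_one_pow_eq_or ℝ (m i).val with h | h <;> rw [h] <;> ring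
  have hnum_le : Real.sin (N * x / 2) ^ 2 ≤ (p i) ^ 2 / 4 := by
    rw [hnum]; have := Real.sin_sq_le_sq (x := p i / 2); nlinarith
  -- denominator: `fold ≤ N |sin (x/2)|` ⇒ `1/sin²(x/2) ≤ N²·wMaj`
  have hden : 1 / Real.sin (x / 2) ^ 2 ≤ (N : ℝ) ^ 2 * wMaj N (m i) := by
    have hf0 : (0 : ℝ) < ((min (m i).val (N - (m i).val) : ℕ) : ℝ) := lt_of_lt_of_le one_pos hf1
    have h1 : ((min (m i).val (N - (m i).val) : ℕ) : ℝ) ^ 2 ≤ ((N : ℝ) * |Real.sin (x / 2)|) ^ 2 :=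
      pow_le_pow_left₀ hf0.le hfold 2
    have h2 : 1 / Real.sin (x / 2) ^ 2 ≤ (N : ℝ) ^ 2 / ((min (m i).val (N - (m i).val) : ℕ) : ℝ) ^ 2 := by
      rw [div_le_div_iff₀ (by positivity) (by positivity), one_mul]
      calc ((min (m i).val (N - (m i).val) : ℕ) : ℝ) ^ 2 ≤ ((N : ℝ) * |Real.sin (x / 2)|) ^ 2 := h1
        _ = (N : ℝ) ^ 2 * Real.sin (x / 2) ^ 2 := by rw [mul_pow, sq_abs]
    have h3 : 1 / (((min (m i).val (N - (m i).val) : ℕ) : ℝ)) ^ 2 ≤ wMaj N (m i) := by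
      unfold wMaj
      rw [if_neg hi]
      rcases Nat.le_total (m i).val (N - (m i).val) with hab | hab
      · rw [min_eq_left hab, one_div]
        exact le_add_of_nonneg_right (by positivity)
      · rw [min_eq_right hab, one_div]
        exact le_add_of_nonneg_left (by positivity)
    calc 1 / Real.sin (x / 2) ^ 2 ≤ (N : ℝ) ^ 2 / ((min (m i).val (N - (m i).val) : ℕ) : ℝ) ^ 2 := h2
      _ = (N : ℝ) ^ 2 * (1 / (((min (m i).val (N - (m i).val) : ℕ) : ℝ)) ^ 2) := by rw [mul_one_div]
      _ ≤ (N : ℝ) ^ 2 * wMaj N (m i) := mul_le_mul_of_nonneg_left h3 (sq_nonneg _)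
  rw [gNormSq_eq_sin_sq_div N hsin0]
  have hs2 : 0 < Real.sin (x / 2) ^ 2 := by positivity
  calc Real.sin (N * x / 2) ^ 2 / Real.sin (x / 2) ^ 2
      = Real.sin (N * x / 2) ^ 2 * (1 / Real.sin (x / 2) ^ 2) := by rw [mul_one_div]
    _ ≤ (p i) ^ 2 / 4 * ((N : ℝ) ^ 2 * wMaj N (m i)) :=
        mul_le_mul hnum_le hden (by positivity) (by positivity)

/-- [folklore] **`|p|²`-CARRYING BLOCK WEIGHT of a nonzero alias**: `w_m ≤ (|p|²/4)·N^D·Π_i wMaj N (m i)` for `m ≠ 0`, `p ∈ [−π, π]^D`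
(one coordinate `i₀` with `m_{i₀} ≠ 0` carries `p_{i₀}² ≤ |p|²` by `gNormSq_kfine_le_of_ne_zero`, the others `‖G‖² ≤ N²·sinWt ≤ N²·wMaj`). -/
theorem blockWt_le_momSq_of_ne_zero {N : ℕ} [NeZero N] {p : Fin D → ℝ} (hp : ∀ i, |p i| ≤ π)
    {m : Fin D → ZMod N} (hm : m ≠ 0) :
    blockWt N p m ≤ momSq p / 4 * ((N : ℝ) ^ D * ∏ i, wMaj N (m i)) := by
  classical
  obtain ⟨i₀, hi₀⟩ : ∃ i, m i ≠ 0 := by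
    by_contra h
    exact hm (funext fun i => by simpa using (not_exists.1 h) i)
  have hN0 : (0 : ℝ) ≤ N := Nat.cast_nonneg N
  have hgen : ∀ i, gNormSq N (kfine N p m i) ≤ (N : ℝ) ^ 2 * wMaj N (m i) := fun i =>
    (gNormSq_le_sq_mul_sinWt N _).trans (mul_le_mul_of_nonneg_left (sinWt_kfine_le_wMaj hp m i) (sq_nonneg _))
  have hsp : gNormSq N (kfine N p m i₀) ≤ momSq p / 4 * ((N : ℝ) ^ 2 * wMaj N (m i₀)) := by
    refine (gNormSq_kfine_le_of_ne_zero hp m hi₀).trans (mul_le_mul_of_nonneg_right ?_ (by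
      exact mul_nonneg (sq_nonneg _) (wMaj_nonneg _ _)))
    exact div_le_div_of_nonneg_right
      (Finset.single_le_sum (f := fun j => p j ^ 2) (fun j _ => sq_nonneg _) (Finset.mem_univ i₀)) (by norm_num)
  have hprod : ∏ i, gNormSq N (kfine N p m i) ≤ momSq p / 4 * ∏ i, ((N : ℝ) ^ 2 * wMaj N (m i)) := by
    rw [← Finset.mul_prod_erase _ _ (Finset.mem_univ i₀), ← Finset.mul_prod_erase _ (fun i => (N : ℝ) ^ 2 * wMaj N (m i))
      (Finset.mem_univ i₀), ← mul_assoc]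
    refine mul_le_mul hsp (Finset.prod_le_prod (fun i _ => gNormSq_nonneg _ _) fun i _ => hgen i)
      (Finset.prod_nonneg fun i _ => gNormSq_nonneg _ _) ?_
    exact mul_nonneg (div_nonneg (momSq_nonneg _) (by norm_num)) (mul_nonneg (sq_nonneg _) (wMaj_nonneg _ _))
  have hpow : ∏ i, ((N : ℝ) ^ 2 * wMaj N (m i)) = (N : ℝ) ^ D * (N : ℝ) ^ D * ∏ i, wMaj N (m i) := by
    rw [Finset.prod_mul_distrib, Finset.prod_const, Finset.card_univ, Fintype.card_fin, ← pow_mul, two_mul, pow_add]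
  unfold blockWt
  by_cases hD : (N : ℝ) ^ D = 0
  · rw [hD, div_zero, zero_mul, mul_zero]
  have hDpos : 0 < (N : ℝ) ^ D := lt_of_le_of_ne (pow_nonneg hN0 D) (Ne.symm hD)
  rw [div_le_iff₀ hDpos]
  calc ∏ i, gNormSq N (kfine N p m i) ≤ momSq p / 4 * ∏ i, ((N : ℝ) ^ 2 * wMaj N (m i)) := hprod
    _ = momSq p / 4 * ((N : ℝ) ^ D * ∏ i, wMaj N (m i)) * (N : ℝ) ^ D := by rw [hpow]; ring

/-! ## §2 The zero-alias data `a⁰_κ, σ⁰, h⁰` and the EXACT identity `σ⁰·h⁰ = 2` -/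

/-- The `m = 0` summand of `a_κ = capDiag N p κ` (same expression as in `CapacitanceScalarBounds.capDiag_zero_term_ge`):
`a⁰_κ = w₀·|s_κ(0)|²/(2L₀)`. -/
def capDiagZero (N : ℕ) (p : Fin D → ℝ) (κ : Fin D) : ℝ :=
  blockWt N p 0 * gNormSq N (kfine N p 0 κ) / (2 * lapR (kfine N p 0))

/-- The `m = 0` summand of `σ = capBorder N p`: `σ⁰ = w₀/L₀²`. -/
def capBorderZero (N : ℕ) (p : Fin D → ℝ) : ℝ := blockWt N p 0 / lapR (kfine N p 0) ^ 2

/-- The zero-alias Schur scalar `h⁰ = Σ_κ 4 sin²(p_κ/2)/a⁰_κ` (the `capH` expression with `a⁰` in place of `a`). -/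
def capHZero (N : ℕ) (p : Fin D → ℝ) : ℝ := ∑ κ, 4 * Real.sin (p κ / 2) ^ 2 / capDiagZero N p κ

/-- [folklore] THE ONE-COORDINATE TELESCOPING IDENTITY at the zero alias: `‖G(p_κ/N, N)‖² · 4 sin²(p_κ/(2N)) = 4 sin²(p_κ/2)`
(`|s_κ(0)|²·|∂̂_κ(k₀)|² = |∂̂_κ(p)|²`: the closed form `sin²(Nx/2)/sin²(x/2)` at `x = p_κ/N`; both sides vanish at `p_κ = 0`). -/
theorem gNormSq_zero_mul_four_sin_sq {N : ℕ} (hN : 1 ≤ N) {p : Fin D → ℝ} (hp : ∀ i, |p i| ≤ π) (κ : Fin D) :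
    gNormSq N (p κ / N) * (4 * Real.sin (p κ / (2 * N)) ^ 2) = 4 * Real.sin (p κ / 2) ^ 2 := by
  have hN0 : (0 : ℝ) < N := by exact_mod_cast hN
  have hy : p κ / N / 2 = p κ / (2 * N) := by ring
  by_cases hs : Real.sin (p κ / (2 * N)) = 0
  · -- then `p_κ = 0` (as `|p_κ/(2N)| < π`) and both sides vanish
    have hybound : |p κ / (2 * N)| < π := by
      rw [abs_div, abs_of_pos (by positivity : (0 : ℝ) < 2 * N), div_lt_iff₀ (by positivity)]
      have h1 : (1 : ℝ) ≤ N := by exact_mod_cast hN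
      nlinarith [abs_nonneg (p κ), Real.pi_pos, hp κ]
    have hp0 : p κ = 0 := by
      rw [Real.sin_eq_zero_iff_of_lt_of_lt (by linarith [(abs_lt.1 hybound).1]) (abs_lt.1 hybound).2] at hs
      field_simp at hs; linarith [hs]
    simp [hp0]
  · rw [gNormSq_eq_sin_sq_div N (by rwa [hy]), hy, show (N : ℝ) * (p κ / N) / 2 = p κ / 2 by field_simp]
    field_simp

/-- [folklore] `Σ_κ 4 sin²(p_κ/2)/‖G(p_κ/N, N)‖² = L₀ = lapR (kfine N p 0)` (sum of the telescoping identity; `‖G‖² ≥ (4/π²)N² > 0`). -/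
theorem sum_four_sin_sq_div_gNormSq_zero {N : ℕ} (hN : 1 ≤ N) {p : Fin D → ℝ} (hp : ∀ i, |p i| ≤ π) :
    ∑ κ, 4 * Real.sin (p κ / 2) ^ 2 / gNormSq N (kfine N p 0 κ) = lapR (kfine N p 0) := by
  have hN0 : (0 : ℝ) < N := by exact_mod_cast hN
  unfold lapR
  refine Finset.sum_congr rfl fun κ _ => ?_
  have hg : 0 < gNormSq N (kfine N p 0 κ) := by
    rw [kfine_zero]
    exact lt_of_lt_of_le (by positivity) (sq_le_gNormSq_zero hN (hp κ))
  rw [kfine_zero] at hg ⊢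
  rw [div_eq_iff hg.ne', show p κ / N / 2 = p κ / (2 * N) by ring, ← gNormSq_zero_mul_four_sin_sq hN hp κ]
  ring

/-- [folklore] Positivity of the zero-alias block weight `w₀ ≥ (4/π²)^D N^D > 0` (`N ≥ 1`). -/
theorem blockWt_zero_pos {N : ℕ} (hN : 1 ≤ N) {p : Fin D → ℝ} (hp : ∀ i, |p i| ≤ π) : 0 < blockWt N p 0 := by
  have hN0 : (0 : ℝ) < N := by exact_mod_cast hN
  exact lt_of_lt_of_le (by positivity) (pow_le_blockWt_zero hN hp)

/-- [folklore] **THE EXACT ZERO-ALIAS IDENTITY `σ⁰ · h⁰ = 2`** (real-currency avatar of `CapacitanceClosedFormGauge.sigma0_mul_hSum0_eq_two`):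
`(w₀/L₀²) · Σ_κ 4 sin²(p_κ/2)·2L₀/(w₀|s_κ(0)|²) = (2/L₀)·Σ_κ 4 sin²(p_κ/(2N)) = 2` for `p ∈ [−π, π]^D ∖ {0}`, every `N ≥ 1`. -/
theorem capBorderZero_mul_capHZero {N : ℕ} (hN : 1 ≤ N) {p : Fin D → ℝ} (hp : ∀ i, |p i| ≤ π) (hp0 : p ≠ 0) :
    capBorderZero N p * capHZero N p = 2 := by
  have hw := blockWt_zero_pos hN hp
  have hL := lapR_zero_pos hN hp hp0
  have hN0 : (0 : ℝ) < N := by exact_mod_cast hN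
  have hg : ∀ κ, 0 < gNormSq N (kfine N p 0 κ) := fun κ => by
    rw [kfine_zero]
    exact lt_of_lt_of_le (by positivity) (sq_le_gNormSq_zero hN (hp κ))
  have hterm : ∀ κ, 4 * Real.sin (p κ / 2) ^ 2 / capDiagZero N p κ
      = 2 * lapR (kfine N p 0) / blockWt N p 0 * (4 * Real.sin (p κ / 2) ^ 2 / gNormSq N (kfine N p 0 κ)) := by
    intro κ
    have hgκ := (hg κ).ne'
    unfold capDiagZero
    field_simp
  have hH : capHZero N p = 2 * lapR (kfine N p 0) / blockWt N p 0 * lapR (kfine N p 0) := by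
    unfold capHZero
    rw [Finset.sum_congr rfl fun κ _ => hterm κ, ← Finset.mul_sum, sum_four_sin_sq_div_gNormSq_zero hN hp]
  rw [hH]
  unfold capBorderZero
  field_simp

/-! ## §3 The `m ≠ 0` SHARES `a_κ − a⁰_κ ≥ 0`, `σ − σ⁰ ≥ 0`: `p`-free bounds (row (i)) and `|p|²`-carrying bounds -/

/-- [folklore] `a_κ = a⁰_κ + Σ_{m ≠ 0} (summand m)`. -/
theorem capDiag_eq_zero_add_sum (N : ℕ) [NeZero N] (p : Fin D → ℝ) (κ : Fin D) :
    capDiag N p κ = capDiagZero N p κ + ∑ m ∈ (Finset.univ : Finset (Fin D → ZMod N)).erase 0,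
      blockWt N p m * gNormSq N (kfine N p m κ) / (2 * lapR (kfine N p m)) := by
  classical
  unfold capDiag capDiagZero
  rw [← Finset.add_sum_erase _ _ (Finset.mem_univ (0 : Fin D → ZMod N))]

/-- [folklore] `σ = σ⁰ + Σ_{m ≠ 0} w_m/L_m²`. -/
theorem capBorder_eq_zero_add_sum (N : ℕ) [NeZero N] (p : Fin D → ℝ) :
    capBorder N p = capBorderZero N p + ∑ m ∈ (Finset.univ : Finset (Fin D → ZMod N)).erase 0,
      blockWt N p m / lapR (kfine N p m) ^ 2 := by
  classical
  unfold capBorder capBorderZero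
  rw [← Finset.add_sum_erase _ _ (Finset.mem_univ (0 : Fin D → ZMod N))]

/-- [folklore] Lower share bound: `a⁰_κ ≤ a_κ` (every summand is `≥ 0`). -/
theorem capDiagZero_le_capDiag (N : ℕ) [NeZero N] (p : Fin D → ℝ) (κ : Fin D) : capDiagZero N p κ ≤ capDiag N p κ := by
  rw [capDiag_eq_zero_add_sum]
  exact le_add_of_nonneg_right (Finset.sum_nonneg fun m _ => capDiag_term_nonneg N p κ m)

/-- [folklore] Lower share bound: `σ⁰ ≤ σ`. -/
theorem capBorderZero_le_capBorder (N : ℕ) [NeZero N] (p : Fin D → ℝ) : capBorderZero N p ≤ capBorder N p := by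
  rw [capBorder_eq_zero_add_sum]
  exact le_add_of_nonneg_right (Finset.sum_nonneg fun m _ => capBorder_term_nonneg N p m)

/-- [folklore] **`p`-FREE SHARE BOUND (row (i))**: `a_κ − a⁰_κ ≤ (aliasWtConst D/2)·N^{D+4}` (leaf-12's `capDiag_term_le` + L06 `alias_sum_le`). -/
theorem capDiag_sub_zero_le {N : ℕ} [NeZero N] (hN : 1 ≤ N) {p : Fin D → ℝ} (hp : ∀ i, |p i| ≤ π) (κ : Fin D) :
    capDiag N p κ - capDiagZero N p κ ≤ aliasWtConst D / 2 * (N : ℝ) ^ (D + 4) := by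
  classical
  have hN0 : (0 : ℝ) < N := by exact_mod_cast hN
  rw [capDiag_eq_zero_add_sum, add_sub_cancel_left]
  calc ∑ m ∈ (Finset.univ : Finset (Fin D → ZMod N)).erase 0, blockWt N p m * gNormSq N (kfine N p m κ) / (2 * lapR (kfine N p m))
      ≤ ∑ m ∈ (Finset.univ : Finset (Fin D → ZMod N)).erase 0, (N : ℝ) ^ (D + 4) / 2 * aliasWtTerm N p m :=
        Finset.sum_le_sum fun m hm => capDiag_term_le hN hp κ (Finset.ne_of_mem_erase hm)
    _ = (N : ℝ) ^ (D + 4) / 2 * ∑ m ∈ (Finset.univ : Finset (Fin D → ZMod N)).erase 0, aliasWtTerm N p m := by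
        rw [Finset.mul_sum]
    _ ≤ (N : ℝ) ^ (D + 4) / 2 * aliasWtConst D := mul_le_mul_of_nonneg_left (alias_sum_le N hp) (by positivity)
    _ = aliasWtConst D / 2 * (N : ℝ) ^ (D + 4) := by ring

/-- [folklore] **`p`-FREE SHARE BOUND (row (i))**: `σ − σ⁰ ≤ (aliasWtConst D/4)·N^{D+4}` (no `1/|p|` powers: a nonzero alias has `N²L_m ≥ 4`). -/
theorem capBorder_sub_zero_le {N : ℕ} [NeZero N] (hN : 1 ≤ N) {p : Fin D → ℝ} (hp : ∀ i, |p i| ≤ π) :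
    capBorder N p - capBorderZero N p ≤ aliasWtConst D / 4 * (N : ℝ) ^ (D + 4) := by
  classical
  have hN0 : (0 : ℝ) < N := by exact_mod_cast hN
  rw [capBorder_eq_zero_add_sum, add_sub_cancel_left]
  calc ∑ m ∈ (Finset.univ : Finset (Fin D → ZMod N)).erase 0, blockWt N p m / lapR (kfine N p m) ^ 2
      ≤ ∑ m ∈ (Finset.univ : Finset (Fin D → ZMod N)).erase 0, (N : ℝ) ^ (D + 4) / 4 * aliasWtTerm N p m :=
        Finset.sum_le_sum fun m hm => capBorder_term_le hN hp (Finset.ne_of_mem_erase hm)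
    _ = (N : ℝ) ^ (D + 4) / 4 * ∑ m ∈ (Finset.univ : Finset (Fin D → ZMod N)).erase 0, aliasWtTerm N p m := by
        rw [Finset.mul_sum]
    _ ≤ (N : ℝ) ^ (D + 4) / 4 * aliasWtConst D := mul_le_mul_of_nonneg_left (alias_sum_le N hp) (by positivity)
    _ = aliasWtConst D / 4 * (N : ℝ) ^ (D + 4) := by ring

/-- [folklore] `Σ_{m ≠ 0} Π_i wMaj N (m i) ≤ 4·aliasWtConst D` (= `5^D − 1`, L06 `sum_prod_wMaj_le`). -/
theorem sum_prod_wMaj_le_four_mul (N : ℕ) [NeZero N] :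
    ∑ m ∈ (Finset.univ : Finset (Fin D → ZMod N)).erase 0, ∏ i, wMaj N (m i) ≤ 4 * aliasWtConst D := by
  have h := sum_prod_wMaj_le (D := D) N
  unfold aliasWtConst
  linarith

/-- [folklore] **`|p|²`-CARRYING SHARE BOUND**: `a_κ − a⁰_κ ≤ (aliasWtConst D/8)·|p|²·N^{D+4}` (per nonzero alias: `w_m ≤ (|p|²/4)N^DΠwMaj`,
`|s_κ(m)|² ≤ N²`, `1/(2L_m) = N²/(2N²L_m) ≤ N²/8`). -/
theorem capDiag_sub_zero_le_momSq {N : ℕ} [NeZero N] (hN : 1 ≤ N) {p : Fin D → ℝ} (hp : ∀ i, |p i| ≤ π) (κ : Fin D) :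
    capDiag N p κ - capDiagZero N p κ ≤ aliasWtConst D / 8 * momSq p * (N : ℝ) ^ (D + 4) := by
  classical
  have hN0 : (0 : ℝ) < N := by exact_mod_cast hN
  have hm0 := momSq_nonneg p
  rw [capDiag_eq_zero_add_sum, add_sub_cancel_left]
  have hterm : ∀ m ∈ (Finset.univ : Finset (Fin D → ZMod N)).erase 0,
      blockWt N p m * gNormSq N (kfine N p m κ) / (2 * lapR (kfine N p m))
        ≤ momSq p / 32 * (N : ℝ) ^ (D + 4) * ∏ i, wMaj N (m i) := by
    intro m hm
    have hm' := Finset.ne_of_mem_erase hm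
    have hL := lapR_pos_of_ne_zero hp hm'
    have h4 := four_le_sq_mul_lapR hp hm'
    have hW : 0 ≤ ∏ i, wMaj N (m i) := Finset.prod_nonneg fun i _ => wMaj_nonneg _ _
    have hnum : blockWt N p m * gNormSq N (kfine N p m κ)
        ≤ (momSq p / 4 * ((N : ℝ) ^ D * ∏ i, wMaj N (m i))) * (N : ℝ) ^ 2 :=
      mul_le_mul (blockWt_le_momSq_of_ne_zero hp hm') (gNormSq_le_sq N _) (gNormSq_nonneg _ _) (by positivity)
    have hinv : 1 / (2 * lapR (kfine N p m)) ≤ (N : ℝ) ^ 2 / 8 := by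
      rw [div_le_div_iff₀ (by positivity) (by norm_num)]; nlinarith
    calc blockWt N p m * gNormSq N (kfine N p m κ) / (2 * lapR (kfine N p m))
        = blockWt N p m * gNormSq N (kfine N p m κ) * (1 / (2 * lapR (kfine N p m))) := by rw [mul_one_div]
      _ ≤ (momSq p / 4 * ((N : ℝ) ^ D * ∏ i, wMaj N (m i))) * (N : ℝ) ^ 2 * ((N : ℝ) ^ 2 / 8) :=
          mul_le_mul hnum hinv (by positivity) (by positivity)
      _ = momSq p / 32 * (N : ℝ) ^ (D + 4) * ∏ i, wMaj N (m i) := by rw [pow_add]; ring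
  calc ∑ m ∈ (Finset.univ : Finset (Fin D → ZMod N)).erase 0, blockWt N p m * gNormSq N (kfine N p m κ) / (2 * lapR (kfine N p m))
      ≤ ∑ m ∈ (Finset.univ : Finset (Fin D → ZMod N)).erase 0, momSq p / 32 * (N : ℝ) ^ (D + 4) * ∏ i, wMaj N (m i) :=
        Finset.sum_le_sum hterm
    _ = momSq p / 32 * (N : ℝ) ^ (D + 4) * ∑ m ∈ (Finset.univ : Finset (Fin D → ZMod N)).erase 0, ∏ i, wMaj N (m i) := by
        rw [Finset.mul_sum]
    _ ≤ momSq p / 32 * (N : ℝ) ^ (D + 4) * (4 * aliasWtConst D) :=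
        mul_le_mul_of_nonneg_left (sum_prod_wMaj_le_four_mul N) (by positivity)
    _ = aliasWtConst D / 8 * momSq p * (N : ℝ) ^ (D + 4) := by ring

/-- [folklore] **`|p|²`-CARRYING SHARE BOUND**: `σ − σ⁰ ≤ (aliasWtConst D/16)·|p|²·N^{D+4}` (`1/L_m² = N⁴/(N²L_m)² ≤ N⁴/16`). -/
theorem capBorder_sub_zero_le_momSq {N : ℕ} [NeZero N] (hN : 1 ≤ N) {p : Fin D → ℝ} (hp : ∀ i, |p i| ≤ π) :
    capBorder N p - capBorderZero N p ≤ aliasWtConst D / 16 * momSq p * (N : ℝ) ^ (D + 4) := by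
  classical
  have hN0 : (0 : ℝ) < N := by exact_mod_cast hN
  have hm0 := momSq_nonneg p
  rw [capBorder_eq_zero_add_sum, add_sub_cancel_left]
  have hterm : ∀ m ∈ (Finset.univ : Finset (Fin D → ZMod N)).erase 0,
      blockWt N p m / lapR (kfine N p m) ^ 2 ≤ momSq p / 64 * (N : ℝ) ^ (D + 4) * ∏ i, wMaj N (m i) := by
    intro m hm
    have hm' := Finset.ne_of_mem_erase hm
    have hL := lapR_pos_of_ne_zero hp hm'
    have h4 := four_le_sq_mul_lapR hp hm'
    have hW : 0 ≤ ∏ i, wMaj N (m i) := Finset.prod_nonneg fun i _ => wMaj_nonneg _ _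
    have h16 : (16 : ℝ) ≤ ((N : ℝ) ^ 2 * lapR (kfine N p m)) ^ 2 := by nlinarith
    have hinv : 1 / lapR (kfine N p m) ^ 2 ≤ (N : ℝ) ^ 4 / 16 := by
      rw [div_le_div_iff₀ (by positivity) (by norm_num)]
      calc 1 * 16 = (16 : ℝ) := one_mul _
        _ ≤ ((N : ℝ) ^ 2 * lapR (kfine N p m)) ^ 2 := h16
        _ = (N : ℝ) ^ 4 * lapR (kfine N p m) ^ 2 := by ring
    calc blockWt N p m / lapR (kfine N p m) ^ 2 = blockWt N p m * (1 / lapR (kfine N p m) ^ 2) := by rw [mul_one_div]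
      _ ≤ (momSq p / 4 * ((N : ℝ) ^ D * ∏ i, wMaj N (m i))) * ((N : ℝ) ^ 4 / 16) :=
          mul_le_mul (blockWt_le_momSq_of_ne_zero hp hm') hinv (by positivity) (by positivity)
      _ = momSq p / 64 * (N : ℝ) ^ (D + 4) * ∏ i, wMaj N (m i) := by rw [pow_add]; ring
  calc ∑ m ∈ (Finset.univ : Finset (Fin D → ZMod N)).erase 0, blockWt N p m / lapR (kfine N p m) ^ 2
      ≤ ∑ m ∈ (Finset.univ : Finset (Fin D → ZMod N)).erase 0, momSq p / 64 * (N : ℝ) ^ (D + 4) * ∏ i, wMaj N (m i) :=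
        Finset.sum_le_sum hterm
    _ = momSq p / 64 * (N : ℝ) ^ (D + 4) * ∑ m ∈ (Finset.univ : Finset (Fin D → ZMod N)).erase 0, ∏ i, wMaj N (m i) := by
        rw [Finset.mul_sum]
    _ ≤ momSq p / 64 * (N : ℝ) ^ (D + 4) * (4 * aliasWtConst D) :=
        mul_le_mul_of_nonneg_left (sum_prod_wMaj_le_four_mul N) (by positivity)
    _ = aliasWtConst D / 16 * momSq p * (N : ℝ) ^ (D + 4) := by ring

/-! ## §4 Sizes of the zero-alias data (Jordan; for the defect estimate of PART 2 `CapacitanceCancellationDefect`) -/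

/-- [folklore] `(4/π²)^{D+1}·N^{D+4}/(2|p|²) ≤ a⁰_κ` (= leaf-12's `capDiag_zero_term_ge`, by name). -/
theorem capDiagZero_ge {N : ℕ} [NeZero N] (hN : 1 ≤ N) {p : Fin D → ℝ} (hp : ∀ i, |p i| ≤ π) (hp0 : p ≠ 0) (κ : Fin D) :
    (4 / π ^ 2) ^ (D + 1) * (N : ℝ) ^ (D + 4) / (2 * momSq p) ≤ capDiagZero N p κ :=
  capDiag_zero_term_ge hN hp hp0 κ

/-- [folklore] `0 < a⁰_κ` on the punctured zone. -/
theorem capDiagZero_pos {N : ℕ} [NeZero N] (hN : 1 ≤ N) {p : Fin D → ℝ} (hp : ∀ i, |p i| ≤ π) (hp0 : p ≠ 0) (κ : Fin D) :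
    0 < capDiagZero N p κ := by
  have hN0 : (0 : ℝ) < N := by exact_mod_cast hN
  have hm := momSq_pos hp0
  exact lt_of_lt_of_le (by positivity) (capDiagZero_ge hN hp hp0 κ)

/-- [folklore] `σ⁰ ≤ π⁴·N^{D+4}/(16|p|⁴)` (`w₀ ≤ N^D`, `N²L₀ ≥ (4/π²)|p|²`; the zero-alias step of leaf-12's `capBorder_le`). -/
theorem capBorderZero_le {N : ℕ} [NeZero N] (hN : 1 ≤ N) {p : Fin D → ℝ} (hp : ∀ i, |p i| ≤ π) (hp0 : p ≠ 0) :
    capBorderZero N p ≤ π ^ 4 * (N : ℝ) ^ (D + 4) / (16 * momSq p ^ 2) := by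
  have hN0 : (0 : ℝ) < N := by exact_mod_cast hN
  have hm := momSq_pos hp0
  have hπ0 : (0 : ℝ) < π := Real.pi_pos
  have hLlow : (4 / π ^ 2 * momSq p / (N : ℝ) ^ 2) ^ 2 ≤ lapR (kfine N p 0) ^ 2 := by
    have := le_sq_mul_lapR_zero hN hp
    refine pow_le_pow_left₀ (by positivity) ?_ 2
    rw [div_le_iff₀ (by positivity)]
    linarith
  unfold capBorderZero
  calc blockWt N p 0 / lapR (kfine N p 0) ^ 2 ≤ (N : ℝ) ^ D / lapR (kfine N p 0) ^ 2 :=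
        div_le_div_of_nonneg_right (blockWt_le_pow hN p 0) (sq_nonneg _)
    _ ≤ (N : ℝ) ^ D / (4 / π ^ 2 * momSq p / (N : ℝ) ^ 2) ^ 2 :=
        div_le_div_of_nonneg_left (by positivity) (by positivity) hLlow
    _ = π ^ 4 * (N : ℝ) ^ (D + 4) / (16 * momSq p ^ 2) := by
        rw [pow_add]
        field_simp
        ring

/-- [folklore] `0 ≤ σ⁰`. -/
theorem capBorderZero_nonneg (N : ℕ) (p : Fin D → ℝ) : 0 ≤ capBorderZero N p :=
  div_nonneg (blockWt_nonneg _ _ _) (sq_nonneg _)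

end Summit.QuantumFields.BalabanUV.Beta.GAN24.CapacitanceCancellation

end
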